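import Literature.NumberTheory.Automorphic.ChevalleyGroupTorusLie
import Literature.NumberTheory.Automorphic.LieAlgebraGLDiagonal
import Literature.NumberTheory.Automorphic.LieAlgebraGLTorusHull
import Literature.NumberTheory.Automorphic.TorusRigidity
import Literature.NumberTheory.Automorphic.RootSpaceSl2
import HarnessLib

/-!
# The Lie algebra of a torus is dual to its character lattice: `Lie(T) ≅ Hom(X*(T), k)`
(trunk T-AUTOMORPHIC, G25 AutomorphicL; Springer, *Linear Algebraic Groups*, 3.2.10 (4), 4.4.10–4.4.13)

For a subgroup `T ≤ GL n k` and an algebraic character `χ ∈ X*(T)` the differential `dχ` is a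
linear form on `𝔤𝔩ₙ` whose restriction to `Lie(T)` does not depend on the polynomial representing
`χ` (`dChar`, `dChar_eq_tangentDeriv`); it is additive in `χ` (`dChar_mul`, `dChar_one`). This
gives the **duality map** `lieTorusDual T : Lie(T) →ₗ[k] (X*(T) →+ k)`, `H ↦ (χ ↦ dχ(H))`, and the
main result of the file is

* **`lieTorusDual_bijective`** — for a torus `T` over an algebraically closed field,
  `H ↦ (χ ↦ dχ(H))` is a `k`-linear bijection `Lie(T) ≅ Hom(X*(T), k)` (Springer 4.4.10 (3) with
  3.2.10 (4): `T ≅ 𝔾ₘ^r` and `Lie(𝔾ₘ^r) = k^r` with `d(t ↦ t^m) = m`).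

Proof. For `T ≤ 𝔻ₙ` Zariski closed: `T` *is* the weight torus of its diagonal weights
(`eq_weightTorus_diagLatticeWt`, by `diagonalGL_mem_of_forall_diagChar`, Springer 3.2.10 (4)), so
`Lie(T) = {diag(ℓ(wt a)) | ℓ ∈ Hom(X*(T), k)}` (`lieAlgebraGL_eq_torusLie_of_le_diagonal`, from
`lieAlgebraGL_weightTorus_le` and `diagonal_mem_lieAlgebraGL_of_forall_diagChar` — no dimension
count is needed); the differential of the monomial character `t^m` is `H ↦ ∑ mᵢ Hᵢᵢ` on `Lie(T)`
(`dChar_diagChar`, comparing the representatives `p · x^{m⁻}` and `x^{m⁺}` modulo `𝓘(T)`), whence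
`dχ(diag(ℓ ∘ wt)) = ℓ(χ)` (`dChar_torusDiag`) and bijectivity. A general torus is conjugate into
`𝔻ₙ` (`exists_conj_le_diagonalSubgroup`) and everything transports (`dChar_conj`).

Also recorded for the Lie-algebra isomorphism theorem (DAG of `chevalley_isomorphism`):
`lie_eq_dChar_smul` (`[H, M] = dχ(H) M` for `H ∈ Lie(T)`, `M ∈ (𝔤𝔩ₙ)_χ`; the `dChar` form of
`lie_eq_tangentDeriv_smul_of_mem_weightSpaceGL`).

## Mathlib

`MvPolynomial`, `Matrix.diagonal`, `AddMonoidHom`. Mathlib has no algebraic tori; nothing here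
duplicates a Mathlib or Literature declaration (searched `dChar`, `lieTorusDual`, `torusLie`:
`ChevalleyGroupTorusLie.lieAlgebraGL_weightTorus_eq` is the weight-torus case, reused here).

## References

* T. A. Springer, *Linear Algebraic Groups*, 2nd ed., Progress in Mathematics 9, Birkhäuser
  (1998), 3.2.2, 3.2.10 (4), 4.4.10 (3), 4.4.13 [SpringerLAG1998].
-/

noncomputable section

open scoped MatrixGroups
open MvPolynomial

namespace Literature.NumberTheory.Automorphic

variable {k : Type*} [Field k] {n : Type*} [Fintype n] [DecidableEq n]

/-! ### The differential of an algebraic character -/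

section DChar

variable {T : Subgroup (GL n k)}

/-- The differential `dχ : 𝔤𝔩ₙ → k` of an algebraic character `χ` of `T ≤ GL n k`, computed on a
polynomial representative (chosen by `IsAlgebraicChar`); on `Lie(T)` it does not depend on that
choice (`dChar_eq_tangentDeriv`). [cite: SpringerLAG1998, 4.4.10–4.4.12] -/
def dChar (χ : ↥(characterLattice T)) : Matrix n n k →ₗ[k] k := tangentDerivLin χ.2.choose

/-- The chosen representative of `χ`. [folklore] -/
lemma dChar_choose_spec (χ : ↥(characterLattice T)) (t : ↥T) :
    (((χ : ↥T →* kˣ) t : kˣ) : k) = MvPolynomial.eval (glCoordFun (t : GL n k)) χ.2.choose :=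
  χ.2.choose_spec t

/-- Two polynomials agreeing on `T` have the same differential on `Lie(T)`. [folklore] -/
lemma tangentDeriv_eq_of_forall_eval_eq {p q : MvPolynomial (GLCoord n) k}
    (hpq : ∀ t : ↥T, MvPolynomial.eval (glCoordFun (t : GL n k)) p =
      MvPolynomial.eval (glCoordFun (t : GL n k)) q)
    {H : Matrix n n k} (hH : H ∈ lieAlgebraGL T) : tangentDeriv p H = tangentDeriv q H := by
  have hmem : p - q ∈ MvPolynomial.vanishingIdeal k (glCoordFun '' (T : Set (GL n k))) := by
    rw [MvPolynomial.mem_vanishingIdeal_iff]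
    rintro _ ⟨t, ht, rfl⟩
    rw [map_sub, sub_eq_zero]
    exact hpq ⟨t, ht⟩
  have h := (mem_lieAlgebraGL_iff.1 hH) _ hmem
  rwa [tangentDeriv_sub, sub_eq_zero] at h

/-- **`dχ(H)` is the differential of any representative** of `χ`, for `H ∈ Lie(T)`. [folklore] -/
theorem dChar_eq_tangentDeriv (χ : ↥(characterLattice T)) {p : MvPolynomial (GLCoord n) k}
    (hp : ∀ t : ↥T, (((χ : ↥T →* kˣ) t : kˣ) : k) = MvPolynomial.eval (glCoordFun (t : GL n k)) p)
    {H : Matrix n n k} (hH : H ∈ lieAlgebraGL T) : dChar χ H = tangentDeriv p H := by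
  rw [dChar, tangentDerivLin_apply]
  exact tangentDeriv_eq_of_forall_eval_eq (fun t => by rw [← dChar_choose_spec, hp]) hH

/-- `d1 = 0` on `Lie(T)`. [folklore] -/
theorem dChar_one {H : Matrix n n k} (hH : H ∈ lieAlgebraGL T) : dChar (1 : ↥(characterLattice T)) H = 0 := by
  rw [dChar_eq_tangentDeriv 1 (p := MvPolynomial.C 1) (fun t => by simp) hH, tangentDeriv_C]

/-- **`d(χψ) = dχ + dψ` on `Lie(T)`** (Leibniz; `χ(1) = ψ(1) = 1`). [cite: SpringerLAG1998, 4.4.12] -/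
theorem dChar_mul (χ ψ : ↥(characterLattice T)) {H : Matrix n n k} (hH : H ∈ lieAlgebraGL T) :
    dChar (χ * ψ) H = dChar χ H + dChar ψ H := by
  have hrep : ∀ t : ↥T, ((((χ * ψ : ↥(characterLattice T)) : ↥T →* kˣ) t : kˣ) : k) =
      MvPolynomial.eval (glCoordFun (t : GL n k)) (χ.2.choose * ψ.2.choose) := by
    intro t
    rw [map_mul, ← dChar_choose_spec, ← dChar_choose_spec]
    simp
  have h1χ : MvPolynomial.eval (glCoordFun (1 : GL n k)) χ.2.choose = 1 := by
    rw [← Subgroup.coe_one T] at *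
    have := dChar_choose_spec χ 1
    rw [map_one] at this
    simpa using this.symm
  have h1ψ : MvPolynomial.eval (glCoordFun (1 : GL n k)) ψ.2.choose = 1 := by
    have := dChar_choose_spec ψ 1
    rw [map_one] at this
    simpa using this.symm
  rw [dChar_eq_tangentDeriv _ hrep hH, tangentDeriv_mul, h1χ, h1ψ, one_mul, mul_one, add_comm]
  rfl

variable (T) in
/-- **The duality map `Lie(T) → Hom(X*(T), k)`, `H ↦ (χ ↦ dχ(H))`.** [cite: SpringerLAG1998, 4.4.13] -/
def lieTorusDual : ↥(lieAlgebraGL T) →ₗ[k] (Additive ↥(characterLattice T) →+ k) where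
  toFun H :=
    { toFun := fun x => dChar (Additive.toMul x) (H : Matrix n n k)
      map_zero' := dChar_one H.2
      map_add' := fun x y => by rw [toMul_add]; exact dChar_mul _ _ H.2 }
  map_add' H H' := by ext x; simp
  map_smul' c H := by ext x; simp

/-- Unfolding of `lieTorusDual`. [folklore] -/
@[simp] lemma lieTorusDual_apply (H : ↥(lieAlgebraGL T)) (x : Additive ↥(characterLattice T)) :
    lieTorusDual T H x = dChar (Additive.toMul x) (H : Matrix n n k) := rfl

/-- `[H, M] = dχ(H) M` for `H ∈ Lie(T)` and a weight vector `M ∈ (𝔤𝔩ₙ)_χ`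
(`lie_eq_tangentDeriv_smul_of_mem_weightSpaceGL` in `dChar` form). [cite: SpringerLAG1998, 4.4.15] -/
theorem lie_eq_dChar_smul (χ : ↥(characterLattice T)) {M : Matrix n n k}
    (hM : M ∈ weightSpaceGL T (χ : ↥T →* kˣ)) {H : Matrix n n k} (hH : H ∈ lieAlgebraGL T) :
    H * M - M * H = dChar χ H • M := by
  rw [lie_eq_tangentDeriv_smul_of_mem_weightSpaceGL (dChar_choose_spec χ) hM hH]
  rfl

end DChar

/-! ### Closed subgroups of the diagonal torus -/

section Diagonal

variable {T : Subgroup (GL n k)}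

/-- The diagonal weights `wt i = (t ↦ t i i) ∈ X*(T)` of `T ≤ 𝔻ₙ`. [cite: SpringerLAG1998, 3.2.2] -/
def diagLatticeWt (hT : T ≤ diagonalSubgroup n k) : n → Additive ↥(characterLattice T) :=
  fun i => weightHom hT (Pi.single i 1)

/-- `∑ aᵢ wt i` is the monomial character `t^a`. [folklore] -/
lemma wtHom_diagLatticeWt (hT : T ≤ diagonalSubgroup n k) (a : n → ℤ) :
    wtHom (diagLatticeWt hT) a = weightHom hT a := by
  rw [wtHom_apply]
  conv_rhs => rw [show a = ∑ i, a i • (Pi.single i (1 : ℤ) : n → ℤ) from by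
    funext j; simp [Finset.sum_apply, Pi.single_apply]]
  rw [map_sum]
  refine Finset.sum_congr rfl fun i _ => ?_
  rw [map_zsmul]; rfl

/-- The diagonal weights generate `X*(T)`. [cite: SpringerLAG1998, 3.2.3] -/
lemma wtHom_diagLatticeWt_surjective (hT : T ≤ diagonalSubgroup n k) :
    Function.Surjective (wtHom (diagLatticeWt hT)) := by
  intro x
  obtain ⟨a, ha⟩ := weightHom_surjective hT x
  exact ⟨a, by rw [wtHom_diagLatticeWt, ha]⟩

/-- `a ∈ Ker (wtHom wt)` iff the monomial character `t^a` is trivial on `T`. [folklore] -/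
lemma mem_ker_wtHom_diagLatticeWt_iff (hT : T ≤ diagonalSubgroup n k) (a : n → ℤ) :
    a ∈ (wtHom (diagLatticeWt hT)).ker ↔ diagChar hT a = 1 := by
  rw [AddMonoidHom.mem_ker, wtHom_diagLatticeWt]
  constructor
  · intro h
    have := congrArg (fun x => ((Additive.toMul x : ↥(characterLattice T)) : ↥T →* kˣ)) h
    simpa [coe_weightHom] using this
  · intro h
    apply Additive.toMul.injective
    apply Subtype.ext
    simpa [coe_weightHom] using h

/-- **A closed subgroup of `𝔻ₙ` is the weight torus of its diagonal weights** (Springer 3.2.10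
(4): `T = ⋂ {Ker t^a | t^a|_T = 1}`, `diagonalGL_mem_of_forall_diagChar`). [cite: SpringerLAG1998, 3.2.10 (4)] -/
theorem eq_weightTorus_diagLatticeWt (hTalg : IsAlgebraicSubgroup T) (hT : T ≤ diagonalSubgroup n k) :
    T = weightTorus k (diagLatticeWt hT) := by
  ext g
  constructor
  · intro hg
    have hgd : diagonalGL n k (diagCoord hT ⟨g, hg⟩) = g := diagonalGL_diagCoord hT ⟨g, hg⟩
    rw [← hgd, diagonalGL_mem_weightTorus_iff (wtHom_diagLatticeWt_surjective hT)]
    intro a ha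
    rw [mem_ker_wtHom_diagLatticeWt_iff] at ha
    have := DFunLike.congr_fun ha ⟨g, hg⟩
    rw [diagChar_apply, MonoidHom.one_apply] at this
    exact this
  · intro hg
    obtain ⟨d, rfl⟩ := weightTorus_le_diagonalSubgroup hg
    refine diagonalGL_mem_of_forall_diagChar hTalg hT d fun a ha => ?_
    exact (diagonalGL_mem_weightTorus_iff (wtHom_diagLatticeWt_surjective hT) d).1 hg a
      ((mem_ker_wtHom_diagLatticeWt_iff hT a).2 ha)

/-- **`Lie(T) = {diag(ℓ(wt a)) | ℓ ∈ Hom(X*(T), k)}`** for a closed `T ≤ 𝔻ₙ` (no hypothesis on `k`):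
`≤` by `lieAlgebraGL_weightTorus_le`, `≥` by `diagonal_mem_lieAlgebraGL_of_forall_diagChar`.
[cite: SpringerLAG1998, 4.4.10 (3) and 3.2.10 (4)] -/
theorem lieAlgebraGL_eq_torusLie_of_le_diagonal (hTalg : IsAlgebraicSubgroup T)
    (hT : T ≤ diagonalSubgroup n k) : lieAlgebraGL T = torusLie (k := k) (diagLatticeWt hT) := by
  apply le_antisymm
  · have h := lieAlgebraGL_weightTorus_le (k := k) (wtHom_diagLatticeWt_surjective hT)
    rwa [← eq_weightTorus_diagLatticeWt hTalg hT] at h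
  · rintro A ⟨ℓ, rfl⟩
    rw [torusDiagLin_apply, torusDiag]
    refine diagonal_mem_lieAlgebraGL_of_forall_diagChar hT fun a ha => ?_
    have hker := (mem_ker_wtHom_diagLatticeWt_iff hT a).2 ha
    rw [AddMonoidHom.mem_ker, wtHom_apply] at hker
    rw [zdot]
    calc ∑ i, (a i : k) * ℓ (diagLatticeWt hT i) = ℓ (∑ i, a i • diagLatticeWt hT i) := by
          rw [map_sum]
          refine Finset.sum_congr rfl fun i _ => ?_
          rw [map_zsmul, zsmul_eq_mul]
      _ = 0 := by rw [hker, map_zero]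

/-- Elements of `Lie(T)`, `T ≤ 𝔻ₙ` closed, are `diag(ℓ ∘ wt)`. [folklore] -/
theorem exists_torusDiag_eq_of_mem_lieAlgebraGL (hTalg : IsAlgebraicSubgroup T)
    (hT : T ≤ diagonalSubgroup n k) {H : Matrix n n k} (hH : H ∈ lieAlgebraGL T) :
    ∃ ℓ : Additive ↥(characterLattice T) →+ k, torusDiag (diagLatticeWt hT) ℓ = H := by
  rw [lieAlgebraGL_eq_torusLie_of_le_diagonal hTalg hT] at hH
  obtain ⟨ℓ, rfl⟩ := hH
  exact ⟨ℓ, rfl⟩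

/-- **The differential of the monomial character `t^m` is `H ↦ ∑ mᵢ Hᵢᵢ` on `Lie(T)`**
(`T ≤ 𝔻ₙ`). If `p` represents `t^m` on `T`, then `p · x^{m⁻} - x^{m⁺}` vanishes on `T`
(`m = m⁺ - m⁻`), so by Leibniz `dp(H) + ⟨m⁻, H⟩ = ⟨m⁺, H⟩`. [cite: SpringerLAG1998, 4.4.10 (3)] -/
theorem dChar_diagChar (hT : T ≤ diagonalSubgroup n k) (m : n → ℤ) {H : Matrix n n k}
    (hH : H ∈ lieAlgebraGL T) :
    dChar (Additive.toMul (weightHom hT m)) H = ∑ i, (m i : k) * H i i := by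
  set χ : ↥(characterLattice T) := Additive.toMul (weightHom hT m) with hχ
  set p := χ.2.choose
  have hp : ∀ t : ↥T, (((χ : ↥T →* kˣ) t : kˣ) : k) = MvPolynomial.eval (glCoordFun (t : GL n k)) p :=
    dChar_choose_spec χ
  set mp : n → ℕ := fun a => (m a).toNat
  set mm : n → ℕ := fun a => (-m a).toNat
  -- `p · x^{m⁻}` and `x^{m⁺}` agree on `T`
  have hagree : ∀ t : ↥T, MvPolynomial.eval (glCoordFun (t : GL n k)) (p * diagMonomial k n mm) =
      MvPolynomial.eval (glCoordFun (t : GL n k)) (diagMonomial k n mp) := by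
    intro t
    rw [map_mul, ← hp t, eval_diagMonomial, eval_diagMonomial]
    have hχt : (((χ : ↥T →* kˣ) t : kˣ) : k) = ∏ i, ((diagCoord hT t i : kˣ) : k) ^ m i := by
      rw [hχ, coe_weightHom, diagChar_apply]
      push_cast
      rfl
    rw [hχt, ← Finset.prod_mul_distrib]
    refine Finset.prod_congr rfl fun i _ => ?_
    rw [coe_apply_diagCoord hT t i i, if_pos rfl, ← zpow_natCast, ← zpow_natCast, ← zpow_add₀
      (Units.ne_zero _)]
    congr 1
    have := toNat_sub_toNat_neg_eq m i
    simp only [mp, mm]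
    omega
  have hderiv := tangentDeriv_eq_of_forall_eval_eq hagree hH
  have hp1 : MvPolynomial.eval (glCoordFun (1 : GL n k)) p = 1 := by
    have := hp 1
    rw [map_one] at this
    simpa using this.symm
  have hd1 : MvPolynomial.eval (glCoordFun (1 : GL n k)) (diagMonomial k n mm) = 1 := by
    rw [eval_diagMonomial]; simp
  rw [tangentDeriv_mul, hp1, hd1, one_mul, mul_one, tangentDeriv_diagMonomial,
    tangentDeriv_diagMonomial] at hderiv
  rw [dChar_eq_tangentDeriv χ hp hH]
  have : tangentDeriv p H = ∑ a, (mp a : k) * H a a - ∑ a, (mm a : k) * H a a := by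
    rw [← hderiv]; ring
  rw [this, ← Finset.sum_sub_distrib]
  refine Finset.sum_congr rfl fun a _ => ?_
  rw [← sub_mul, ← Int.cast_natCast, ← Int.cast_natCast (R := k) (mm a), ← Int.cast_sub]
  congr 2
  exact toNat_sub_toNat_neg_eq m a

/-- **`dχ (diag(ℓ ∘ wt)) = ℓ(χ)`**: on the element of `Lie(T)` defined by `ℓ ∈ Hom(X*(T), k)` the
differential of `χ` is `ℓ(χ)` (`T ≤ 𝔻ₙ` closed). [cite: SpringerLAG1998, 4.4.13] -/
theorem dChar_torusDiag (hTalg : IsAlgebraicSubgroup T) (hT : T ≤ diagonalSubgroup n k)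
    (ℓ : Additive ↥(characterLattice T) →+ k) (x : Additive ↥(characterLattice T)) :
    dChar (Additive.toMul x) (torusDiag (diagLatticeWt hT) ℓ) = ℓ x := by
  obtain ⟨m, rfl⟩ := weightHom_surjective hT x
  have hmem : torusDiag (diagLatticeWt hT) ℓ ∈ lieAlgebraGL T := by
    rw [lieAlgebraGL_eq_torusLie_of_le_diagonal hTalg hT]; exact torusDiag_mem_torusLie ℓ
  rw [dChar_diagChar hT m hmem]
  simp only [torusDiag_apply, if_true]
  rw [← wtHom_diagLatticeWt, wtHom_apply, map_sum]
  refine Finset.sum_congr rfl fun i _ => ?_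
  rw [map_zsmul, zsmul_eq_mul]

/-- **`Lie(T) ≅ Hom(X*(T), k)` for a closed subgroup of `𝔻ₙ`.** [cite: SpringerLAG1998, 4.4.13] -/
theorem lieTorusDual_bijective_of_le_diagonal (hTalg : IsAlgebraicSubgroup T)
    (hT : T ≤ diagonalSubgroup n k) : Function.Bijective (lieTorusDual T) := by
  constructor
  · intro H H' hHH'
    obtain ⟨ℓ, hℓ⟩ := exists_torusDiag_eq_of_mem_lieAlgebraGL hTalg hT H.2
    obtain ⟨ℓ', hℓ'⟩ := exists_torusDiag_eq_of_mem_lieAlgebraGL hTalg hT H'.2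
    have hll : ℓ = ℓ' := by
      refine AddMonoidHom.ext fun x => ?_
      have h := DFunLike.congr_fun hHH' x
      rw [lieTorusDual_apply, lieTorusDual_apply] at h
      have e1 := dChar_torusDiag hTalg hT ℓ x
      have e2 := dChar_torusDiag hTalg hT ℓ' x
      rw [hℓ] at e1
      rw [hℓ'] at e2
      rw [← e1, ← e2, h]
    apply Subtype.ext
    rw [← hℓ, ← hℓ', hll]
  · intro ℓ
    have hmem : torusDiag (diagLatticeWt hT) ℓ ∈ lieAlgebraGL T := by
      rw [lieAlgebraGL_eq_torusLie_of_le_diagonal hTalg hT]; exact torusDiag_mem_torusLie ℓ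
    refine ⟨⟨_, hmem⟩, AddMonoidHom.ext fun x => ?_⟩
    rw [lieTorusDual_apply]
    exact dChar_torusDiag hTalg hT ℓ x

end Diagonal

/-! ### Transport along conjugation and the general torus -/

section Conj

variable {T : Subgroup (GL n k)}

omit [Fintype n] [DecidableEq n] in
/-- `g⁻¹ (g A g⁻¹) g = A`. [folklore] -/
lemma units_inv_conj_conj [Fintype n] [DecidableEq n] (g : GL n k) (A : Matrix n n k) :
    ((g⁻¹ : GL n k) : Matrix n n k) * ((g : Matrix n n k) * A * ((g⁻¹ : GL n k) : Matrix n n k)) *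
      (g : Matrix n n k) = A := by
  rw [← mul_assoc, ← mul_assoc, ← Units.val_mul, inv_mul_cancel, Units.val_one, one_mul, mul_assoc,
    ← Units.val_mul, inv_mul_cancel, Units.val_one, mul_one]

omit [Fintype n] [DecidableEq n] in
/-- `g (g⁻¹ A g) g⁻¹ = A`. [folklore] -/
lemma units_conj_inv_conj [Fintype n] [DecidableEq n] (g : GL n k) (A : Matrix n n k) :
    (g : Matrix n n k) * (((g⁻¹ : GL n k) : Matrix n n k) * A * (g : Matrix n n k)) *
      ((g⁻¹ : GL n k) : Matrix n n k) = A := by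
  rw [← mul_assoc, ← mul_assoc, ← Units.val_mul, mul_inv_cancel, Units.val_one, one_mul, mul_assoc,
    ← Units.val_mul, mul_inv_cancel, Units.val_one, mul_one]

/-- `Lie(g T g⁻¹) = g Lie(T) g⁻¹`, membership form. [cite: SpringerLAG1998, 4.4.5 (ii)] -/
theorem mem_lieAlgebraGL_map_conj_iff (g : GL n k) {H : Matrix n n k} :
    (g : Matrix n n k) * H * ((g⁻¹ : GL n k) : Matrix n n k) ∈
        lieAlgebraGL (T.map (MulAut.conj g : GL n k →* GL n k)) ↔ H ∈ lieAlgebraGL T := by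
  constructor
  · intro h
    have h' := conj_mem_lieAlgebraGL_map_conj g⁻¹ h
    rwa [map_conj_inv_map_conj, inv_inv, units_inv_conj_conj] at h'
  · exact conj_mem_lieAlgebraGL_map_conj g

/-- Conjugating back: `g⁻¹ H₀ g ∈ Lie(T)` for `H₀ ∈ Lie(g T g⁻¹)`. [folklore] -/
theorem inv_conj_mem_lieAlgebraGL_of_mem_map_conj (g : GL n k) {H₀ : Matrix n n k}
    (hH₀ : H₀ ∈ lieAlgebraGL (T.map (MulAut.conj g : GL n k →* GL n k))) :
    ((g⁻¹ : GL n k) : Matrix n n k) * H₀ * (g : Matrix n n k) ∈ lieAlgebraGL T := by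
  have h := conj_mem_lieAlgebraGL_map_conj g⁻¹ hH₀
  rwa [map_conj_inv_map_conj, inv_inv] at h

/-- The pull-back `χ₀ ↦ χ₀ ∘ Int(g)` of characters of `g T g⁻¹` to characters of `T`, on the
differentials: `d(χ₀ ∘ Int(g))(H) = dχ₀ (g H g⁻¹)` for `H ∈ Lie(T)`. [cite: SpringerLAG1998, 4.4.5 (ii)] -/
theorem dChar_conj (g : GL n k) (χ₀ : ↥(characterLattice (T.map (MulAut.conj g : GL n k →* GL n k))))
    {H : Matrix n n k} (hH : H ∈ lieAlgebraGL T) :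
    dChar (characterLatticeConjEquiv g T χ₀) H =
      dChar χ₀ ((g : Matrix n n k) * H * ((g⁻¹ : GL n k) : Matrix n n k)) := by
  set p₀ := χ₀.2.choose
  have hp₀ := dChar_choose_spec χ₀
  -- `p₀ ∘ Int(g)` represents `χ₀ ∘ Int(g)` on `T`
  have hrep : ∀ t : ↥T, ((((characterLatticeConjEquiv g T χ₀ : ↥(characterLattice T)) : ↥T →* kˣ) t
      : kˣ) : k) = MvPolynomial.eval (glCoordFun (t : GL n k)) (MvPolynomial.bind₁ (conjPolyGL g g⁻¹) p₀) := by
    intro t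
    rw [eval_bind₁]
    have hfun : (fun i => MvPolynomial.eval (glCoordFun (t : GL n k)) (conjPolyGL g g⁻¹ i)) =
        glCoordFun (g * (t : GL n k) * g⁻¹) := funext fun i => eval_conjPolyGL g g⁻¹ _ i
    rw [hfun, ← coe_conjEquiv_apply g t, ← hp₀]
    rfl
  rw [dChar_eq_tangentDeriv _ hrep hH,
    dChar_eq_tangentDeriv χ₀ hp₀ ((mem_lieAlgebraGL_map_conj_iff g).2 hH), tangentDeriv, tangentDeriv,
    MvPolynomial.aeval_bind₁]
  have hpt : (fun i => MvPolynomial.aeval (dualPoint H) (conjPolyGL g g⁻¹ i)) =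
      dualPoint ((g : Matrix n n k) * H * ((g⁻¹ : GL n k) : Matrix n n k)) :=
    funext (aeval_dualPoint_conjPolyGL H g)
  rw [hpt]

/-- **`Lie(T) ≅ Hom(X*(T), k)` for a torus `T`** over an algebraically closed field: the duality map
`H ↦ (χ ↦ dχ(H))` is bijective (conjugate into `𝔻ₙ` and use the diagonal case).
[cite: SpringerLAG1998, 4.4.13 with 3.2.10 (4)] -/
theorem lieTorusDual_bijective [IsAlgClosed k] (hT : IsTorusSubgroup T) :
    Function.Bijective (lieTorusDual T) := by
  obtain ⟨g, hg⟩ := exists_conj_le_diagonalSubgroup hT.2.1 hT.2.2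
  rw [MulEquiv.toMonoidHom_eq_coe] at hg
  have hT₀alg : IsAlgebraicSubgroup (T.map (MulAut.conj g : GL n k →* GL n k)) := hT.1.1.map_conj' g
  have hbij := lieTorusDual_bijective_of_le_diagonal hT₀alg hg
  -- the additive form of `X*(g T g⁻¹) ≃ X*(T)`
  let eA : Additive ↥(characterLattice (T.map (MulAut.conj g : GL n k →* GL n k))) ≃+
      Additive ↥(characterLattice T) := MulEquiv.toAdditive (characterLatticeConjEquiv g T)
  have heA : ∀ x₀, Additive.toMul (eA x₀) = characterLatticeConjEquiv g T (Additive.toMul x₀) :=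
    fun _ => rfl
  constructor
  · intro H H' hHH'
    apply Subtype.ext
    have hmem : (g : Matrix n n k) * (H : Matrix n n k) * ((g⁻¹ : GL n k) : Matrix n n k) ∈
        lieAlgebraGL (T.map (MulAut.conj g : GL n k →* GL n k)) := (mem_lieAlgebraGL_map_conj_iff g).2 H.2
    have hmem' : (g : Matrix n n k) * (H' : Matrix n n k) * ((g⁻¹ : GL n k) : Matrix n n k) ∈
        lieAlgebraGL (T.map (MulAut.conj g : GL n k →* GL n k)) := (mem_lieAlgebraGL_map_conj_iff g).2 H'.2
    have himg : lieTorusDual _ ⟨_, hmem⟩ = lieTorusDual _ ⟨_, hmem'⟩ := by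
      refine AddMonoidHom.ext fun x₀ => ?_
      rw [lieTorusDual_apply, lieTorusDual_apply]
      have h := DFunLike.congr_fun hHH' (eA x₀)
      rw [lieTorusDual_apply, lieTorusDual_apply, heA, dChar_conj g _ H.2, dChar_conj g _ H'.2] at h
      exact h
    have heq := congrArg Subtype.val (hbij.1 himg)
    have heq' := congrArg (fun M : Matrix n n k => ((g⁻¹ : GL n k) : Matrix n n k) * M * (g : Matrix n n k)) heq
    simpa only [units_inv_conj_conj] using heq'
  · intro ℓ
    -- transport `ℓ` to `g T g⁻¹`, solve there, conjugate back
    obtain ⟨H₀, hH₀⟩ := hbij.2 (ℓ.comp eA.toAddMonoidHom)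
    have hmem := inv_conj_mem_lieAlgebraGL_of_mem_map_conj g H₀.2
    refine ⟨⟨_, hmem⟩, AddMonoidHom.ext fun x => ?_⟩
    obtain ⟨x₀, rfl⟩ := eA.surjective x
    have h1 : lieTorusDual T ⟨_, hmem⟩ (eA x₀) =
        dChar (characterLatticeConjEquiv g T (Additive.toMul x₀))
          (((g⁻¹ : GL n k) : Matrix n n k) * (H₀ : Matrix n n k) * (g : Matrix n n k)) := rfl
    have h2 : dChar (characterLatticeConjEquiv g T (Additive.toMul x₀))
          (((g⁻¹ : GL n k) : Matrix n n k) * (H₀ : Matrix n n k) * (g : Matrix n n k)) =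
        dChar (Additive.toMul x₀) (H₀ : Matrix n n k) := by
      refine (dChar_conj g (Additive.toMul x₀) hmem).trans ?_
      congr 1
      exact units_conj_inv_conj g (H₀ : Matrix n n k)
    have h3 : dChar (Additive.toMul x₀) (H₀ : Matrix n n k) = ℓ (eA x₀) :=
      DFunLike.congr_fun hH₀ x₀
    exact h1.trans (h2.trans h3)

end Conj

end Literature.NumberTheory.Automorphic
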